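import Summits.QuantumFields.YangMills.Theorems.SoloBlindOddTorusRP
import Summits.QuantumFields.YangMills.Theorems.SoloBlindStrongCouplingRung
import HarnessLib

/-!
# The time correlator of `YangMills` is non-negative (solo-QuantumFields-blind, rung D8, part 2)

## … on the time-zero spatial diagonal, on the statement's own odd tori

`Summit.QuantumFields.YangMills` asks, inside `HasLatticeMassGap r sch Δ`, for
`|latticeConnectedCorr r.ρ β (2S+1) A B n| ≤ C e^{-Δ a n}`: an exponential bound on the connected
correlation, in the Wilson state of the odd torus `(ℤ/(2S+1))⁴`, of a gauge-invariant local
observable `A` with the time-`n` translate of `B`.  From part 1 (`SoloBlindOddTorusRP`: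
Osterwalder–Seiler positivity on odd tori, all separations) and the dictionary
`latticeConnectedCorr_eq_wilsonExpectation` (rung D4):

* `latticeConnectedCorr_self_nonneg` — for every compact `G`, continuous matrix model `ρ`,
  `β ≥ 0`, `S ≥ 1`, every `A : YMSpecies G` supported on spatial links of the time-zero
  hyperplane, and every `n : ℕ`:  `0 ≤ latticeConnectedCorr ρ β (2S+1) A.F A.F n`;
* `latticeConnectedCorr_plaquette_nonneg` — the instance for the spatial plaquette fields
  `Re tr ρ'(U_p)` (`plaquetteObservable ρ' _ i j`, `i, j ≠ 0`, any continuous representation `ρ'`).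

So on the diagonal of the time-zero spatial algebra the absolute value in `HasLatticeMassGap` is
redundant: the statement asks there for an upper bound on a non-negative, reflection-positive
sequence, on its own tori — the setting in which spectral/transfer-matrix arguments
(monotonicity, log-convexity, the infrared alternatives of the accompanying obstruction paper)
apply without the even-side-length proviso of D7.

References: K. Osterwalder, E. Seiler, Ann. Phys. 110 (1978) 440, §2; E. Seiler, LNP 159 (1982)
Ch. 2; J. Glimm, A. Jaffe, *Quantum Physics* (1987) §6.1. [folklore consequence of OS positivity;
the summit-native typed statement is this unit's]
-/

open MeasureTheory
open Literature.MathematicalPhysics.QuantumFieldTheory Literature.MathematicalPhysics.QuantumLattice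

noncomputable section

namespace Summit.QuantumFields.YangMills.Theorems.SoloBlind

/-! ### The summit-native corollary -/

section Summit

variable {G : Type} [Group G] [TopologicalSpace G] [IsTopologicalGroup G] [CompactSpace G]
  [MeasurableSpace G] [BorelSpace G]

/-- **The time correlator of the statement is non-negative on the time-zero spatial diagonal**
(rung D8).  For every compact `G`, continuous matrix model `ρ`, `β ≥ 0`, `S ≥ 1`, every
gauge-invariant local observable `A : YMSpecies G` supported on spatial links of the time-zero
hyperplane, and every `n : ℕ`:  `0 ≤ latticeConnectedCorr ρ β (2S+1) A.F A.F n` — the quantity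
whose absolute value `HasLatticeMassGap` bounds by `C e^{-Δ a n}` is itself non-negative.
[folklore consequence of OS positivity on the odd torus] -/
theorem latticeConnectedCorr_self_nonneg {N : ℕ} (ρ : G →* Matrix (Fin N) (Fin N) ℂ)
    (hρ : Continuous ρ) {β : ℝ} (hβ : 0 ≤ β) {S : ℕ} (hS : 1 ≤ S) (A : YMSpecies G)
    (hA : ∀ e ∈ A.supp, e.1 0 = 0 ∧ e.2 ≠ 0) (n : ℕ) :
    0 ≤ latticeConnectedCorr ρ β (2 * S + 1) A.F A.F n := by
  have hL : Odd (2 * S + 1) := ⟨S, rfl⟩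
  have hL3 : 3 ≤ 2 * S + 1 := by omega
  rw [latticeConnectedCorr_eq_wilsonExpectation]
  set F : GaugeConfig 4 (2 * S + 1) G → ℝ := toTorusObservable (2 * S + 1) A.F with hF
  have hFm : Measurable F := A.measurable.comp (measurable_torusLift (2 * S + 1))
  have hFb : ∃ C : ℝ, ∀ U, |F U| ≤ C := by
    obtain ⟨C, hC⟩ := A.bounded
    exact ⟨C, fun U => hC _⟩
  have hF0 : DependsOn F {e : Edge 4 (2 * S + 1) | e.1 0 = 0 ∧ e.2 ≠ 0} := by
    intro U V hUV
    simp only [hF, toTorusObservable_apply]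
    apply A.isCylinder
    intro e he
    obtain ⟨he0, he2⟩ := hA e (Finset.mem_coe.mp he)
    simp only [torusLift, Function.comp_apply]
    apply hUV
    refine ⟨?_, he2⟩
    simp [torusEdge, he0]
  have hprod : toTorusObservable (2 * S + 1)
        (fun U => A.F U * A.F (configShift (-Pi.single 0 (n : ℤ)) U)) =
      fun U => F U * F (torusConfigShift
        (-(Pi.single (0 : Fin 4) ((n : ℤ) : ZMod (2 * S + 1)) : Site 4 (2 * S + 1))) U) := by
    funext U
    have h := congrFun (toTorusObservable_comp_configShift (G := G) (2 * S + 1)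
      (-Pi.single (0 : Fin 4) (n : ℤ)) A.F) U
    have hv : Literature.Probability.LatticeModels.Torus.proj (2 * S + 1)
        (-Pi.single (0 : Fin 4) (n : ℤ)) =
          -(Pi.single (0 : Fin 4) ((n : ℤ) : ZMod (2 * S + 1)) : Site 4 (2 * S + 1)) := by
      funext i
      by_cases hi : i = 0
      · subst hi; simp
      · simp [hi]
    simp only [toTorusObservable, Function.comp_apply, hv] at h
    simp only [toTorusObservable_apply, hF]
    rw [← h]
  rw [hprod]
  have key := wilsonExpectation_timeZero_connected_nonneg (d := 4) ρ hL hL3 hρ hβ hFm hFb hF0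
    ((n : ℤ) : ZMod (2 * S + 1))
  have h1 : wilsonExpectation ρ β
      (fun U => F (torusConfigShift
        (-(Pi.single (0 : Fin 4) ((n : ℤ) : ZMod (2 * S + 1)) : Site 4 (2 * S + 1))) U)) =
      wilsonExpectation ρ β F :=
    wilsonExpectation_comp_torusConfigShift ρ β _ F
  rw [h1] at key
  exact key

/-- **Instance: spatial plaquette fields.**  For spatial directions `i, j ≠ 0` the plaquette
field `Re tr ρ'(U_p)` at the origin (`plaquetteObservable ρ' _ i j`, any continuous
representation `ρ'`) is a time-zero spatial observable, so its time correlator in the statement's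
sense is non-negative at every separation, on every odd torus `(ℤ/(2S+1))⁴`, `S ≥ 1`, for every
action model `ρ` and `β ≥ 0`. [folklore] -/
theorem latticeConnectedCorr_plaquette_nonneg [SecondCountableTopology G] {N M : ℕ}
    (ρ : G →* Matrix (Fin N) (Fin N) ℂ) (hρ : Continuous ρ) (ρ' : G →* Matrix (Fin M) (Fin M) ℂ)
    (hρ' : Continuous ρ') {β : ℝ} (hβ : 0 ≤ β) {S : ℕ} (hS : 1 ≤ S) {i j : Fin 4} (hi : i ≠ 0)
    (hj : j ≠ 0) (n : ℕ) :
    0 ≤ latticeConnectedCorr ρ β (2 * S + 1) (plaquetteObservable ρ' hρ' i j).F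
      (plaquetteObservable ρ' hρ' i j).F n := by
  refine latticeConnectedCorr_self_nonneg ρ hρ hβ hS _ (fun e he => ?_) n
  change e ∈ originPlaquetteSupport i j at he
  simp only [originPlaquetteSupport, Finset.mem_insert, Finset.mem_singleton] at he
  rcases he with rfl | rfl | rfl | rfl
  · exact ⟨rfl, hi⟩
  · exact ⟨by simp [hi.symm], hj⟩
  · exact ⟨by simp [hj.symm], hi⟩
  · exact ⟨rfl, hj⟩

end Summit

end Summit.QuantumFields.YangMills.Theorems.SoloBlind

end
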